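import Literature.MathematicalPhysics.QuantumFieldTheory.Balaban1983to89.B9LeafXCodedKnitUParHX

/-!
# `Balaban1983to89.B9LeafXCodedKnitUParHXJ` — [B9] THE LEAF OVER THE CODED KNIT CARRIER FROM PRINTED ROWS ALREADY RE-INDEXED ALONG THE SUB-FAMILY `f`
# (R1 item 1∕≈18 of IR-N06-SECTION-2, director-ym №524 (3) «authorised in principle, STAGED»; seat `pub-ymgap-dag-n06-d` g29, 2026-08-31)

T. Bałaban, *Propagators for lattice gauge theories in a background field*, Commun. Math. Phys. **99** (1985) 389–434 [Balaban1985BackgroundPropagators] = [B9], Thms 3.1–3.15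
pp. 397–432 (the fifteen numbered statements + (3.49), (3.132), Thm 3.14-local = `DagBinding.B9LeafX`); [Balaban1984PropagatorsII] Props. 2.2–2.6 (the `U ≡ 1` block).

statement-level skeleton of published theorems with citation tags; proofs where landed; nothing here is a claim about the Yang–Mills mass gap

WHY THIS FILE.  KERNEL FACT (F1) of the IR-N06-SECTION-2 census: the coded knit carrier `carriersYUParHX P G f b C37 C38 parA parH OA ops` has index type `J`
(`carriersYUParHX_I9 = J := rfl`, `…_geo9 j = geo9Y (f j)`), so its leaf `B9LeafX` quantifies every printed row over the SUB-FAMILY `f : J → MemberY …` only; §3 of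
`B9LeafXCodedKnitUParHX` (`b9LeafX_carriersYUParHX`) nevertheless takes the fourteen printed rows over the FULL family `geo9Y` and re-indexes them itself
(`B9LeafXCodedKnitU.*_reindex f`, l.371–396 there).  That typing — not the leaf, not node00-def-Y's objects — is what forces the N06 certificates («KE₉X» ✓p813813 and
its chain) to display [B9] rows 15∕16∕17 (Thm 3.2 (3.48), Thm 3.11∕3.3 row 17) at EVERY member, including the inner-corner members where the tree's proofs (which need a
section of the index-bond block map `β`) do not reach and the rows are OPEN (node00-def-Y's label of record, director-ym №524 (2)).  THIS FILE is the APEX of the J-twin road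
(R1): ★★★ `b9LeafX_carriersYUParHX_ofReindexed` — the same leaf from the fourteen rows ALREADY along `f`; every other hypothesis and the proof body verbatim (generator
`mkUParHXJ.py` over §3's tree bytes: the three whole-family derivations `B9.thm31_of_thm37 ∕ thm32_of_thm39 ∕ thm33_of_thm37_310` are index-generic and run at `J`; the
fourteen `…_reindex f` calls are dropped; the `U ≡ 1` block stays derived over the full family from `h6` + the `U = 1` comparisons and re-indexed).  §3 is the special case
`tXX := …_reindex f … tXX_full` of this theorem.  CONSUMERS: none today — the J-twins of the producer cone («KD‴»ᴶ, the Sect.-D layers, the (3.49)∕(3.132)∕Thm-3.9∕3.11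
readers) are STAGED (№524 (3): by-name, one file at a time, idle stretches); when they exist, «KCXS»ᴶ∕«KE»ᴶ call this constructor and rows 15∕16∕17 leave the head for the
leaf as typed (`J := SCMemberY`, the K1 face's (α5)).
HONEST SCOPE.  Kernel bookkeeping (one theorem, 0 `def`, 0 `sorry`, standard axioms); nothing of [B9] asserted beyond the landed §3; NEW sibling file, nothing landed is
modified; count-neutral; N06 NOT discharged; the question «are the record's RG members section-carrying?» is NOT answered here (it lives at the K1 face ∕ NODE O join);
one finite 𝕋⁴ programme at fixed ε — nothing continuum ∕ OS ∕ mass gap ∕ Clay; the Yang–Mills mass gap is NOT proved.  `--supports stmt-QuantumFields-27239`.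
-/

noncomputable section

namespace Literature.MathematicalPhysics.QuantumFieldTheory.Balaban1983to89.B9LeafXCodedKnitUParHXJ

open DagBinding (PrintedCarriers9X B9LeafX B6BlockParam)
open B9PinMembersKLevelV1 (MemberY geo9Y bg9Y)
open B9BackgroundsKLevelV1P (bg9KP)
open B9BackgroundsKLevelV1R (RegFamY bg9YR kernelFamilyR kernelFamilyRY siteKernelR fineKernelR rwExpansionR rwKernelExpansionR hKernelR hKernelRY)
open B9PinGeometryKLevelV1 (dOmegaY OmKY inΛY unitDistY InCubeY c35Y c35Y_pos dictAtOneY not_inCubeY)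
open B9PinCarriersKLevelV1 (OperatorLayerY)
open B9PinCarriersKLevelV1R (carriersYR)
open B9SectBCodedClassR (RegExtraY regC335 regC336 bg9YC extraY extraYPb)
open B9SectBGpLettersY (GVal)
open B9SectBCodedCarrier (CCfg Coding pullK pullS thm33Printed_coded)
open B9SectBCodedCarrierPullbacks (pullF pullH pullRW pullRWK pullC pullPK pullPH pullPK₀ thm31Printed_coded thm37Printed_coded cor38Printed_coded thm39Printed_coded
  thm310Printed_coded thm311Printed_coded thm312Printed_coded thm313Printed_coded thm314Printed_coded thm314LocalPrinted_coded thm315FullPrinted_coded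
  stmt349Printed_coded stmt3132Printed_coded)
open B9SectBGpFrameCodedYR (codingYx)
open B9SectBCodedReadingsUR (KSCU KACU SectBStepU)
open B9SectBCodedReadingsUParH (KSCUPar SectBStepUPar)
open B9SectBCodedChainAnR (IsAnKY)
open B9SectBKerFrameCodedYR (CinvY)
open B9SectBCodedClassGY (C37GY)
open B9SectBStepsKSCUR (KSCU_members_base KACU_members_base ineq342_346_347_congr thms_KSCU_base_iff)
open B9SectBGpTransferInYR (ineq343_345_congr)
open B9SectBStepUOfMembersR (thm32Printed_codedU thm33Printed_codedU)
open B9LeafKnitOn (baseU1_of_b6BlockParam_on)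
open B9Eq360DeltaPrimeAY (AfldY)
open B6Ineq2142KLevelV1 (β)
open B7Prop2SpecialUnitary (specialUnitaryUnits)
open Node00 (SiteY BlkY IBondY CfgY SiteParY BondParY BondOpY GAY GpY CY parSymY parBY kernelFamilyS kernelFamilyB siteKernelOfOp carriersYU carriersYUPar
  carriersYUParH codingYU cqY OpsY Stage3Params Y9OfRecordP Y9OfRecordUParH Y9OfRecordUPbParH)
open B9LeafXCodedKnitU (thm37Printed_reindex cor38Printed_reindex thm39Printed_reindex thm310Printed_reindex thm311Printed_reindex thm312Printed_reindex
  thm313Printed_reindex thm314Printed_reindex thm314LocalPrinted_reindex thm315FullPrinted_reindex stmt349Printed_reindex stmt3132Printed_reindex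
  baseU1Printed_reindex thm31Printed_reindex thm32Printed_reindex thm33Printed_reindex)
open B9LeafXCodedKnitUParH (thm31Printed_codedUPar baseU1Printed_codedUPar thm33Printed_codedUPar)
open scoped Matrix.Norms.L2Operator

variable {d ℓ : ℕ} {hd : 1 ≤ d + 1} {hL : Odd (ℓ + 1) ∧ 1 < ℓ + 1} {b₀ b₁ : ℝ} {Mstar : ℕ}
open B9LeafXCodedKnitUParHX (carriersYUParHX)

/-! ## ★★★ The leaf over the coded carrier from printed rows already along `f` -/

section Knit

variable {𝔸 : Type} [NormedRing 𝔸] (P : RegExtraY d ℓ hd hL b₀ b₁ Mstar 𝔸) [NormedAlgebra ℂ 𝔸] [CompleteSpace 𝔸] (G : Subgroup 𝔸ˣ)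
  {J : Type} (f : J → MemberY d ℓ hd hL b₀ b₁ Mstar)
  (C38 : ∀ j : J, ℝ → CfgY 𝔸 (f j).toKIdx → AfldY 𝔸 (f j).toKIdx → Prop)
  {ι : Type} [Fintype ι] (b : Module.Basis ι ℝ 𝔸) (C37 : ∀ j : J, ℝ → CfgY 𝔸 (f j).toKIdx → AfldY 𝔸 (f j).toKIdx → Prop)
  (parA parH : ∀ j : J, SiteParY 𝔸 (f j).toKIdx) (OA : ∀ j : J, BondOpY 𝔸 (f j).toKIdx)
  (ops : ∀ x : MemberY d ℓ hd hL b₀ b₁ Mstar, OperatorLayerY d ℓ hd hL b₀ b₁ Mstar 𝔸 G x)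

/-- ★★★ **`B9LeafX (carriersYUParHX P G f b C37 C38 parA parH OA ops)` FROM THE PRINTED ROWS ALREADY RE-INDEXED ALONG `f`** (R1 item 1, director-ym №524 (3),
STAGED): the sibling of `B9LeafXCodedKnitUParHX.b9LeafX_carriersYUParHX` (§3 there) whose fourteen printed-row hypotheses `t37 c38 t39 t310 hsum hksum t311 t312 t313 t314 t315
s349 s3132 t314loc` are taken in the shapes of `B9LeafXCodedKnitU.*_reindex f` — over `(fun j => geo9Y (f j))`, `(fun j => bg9YR 𝔸 G (regC335 P) (regC336 P) (f j))`, the kernels of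
`ops (f j)` — instead of over the full member family `geo9Y`; `hone`, the `U = 1` comparisons `hGp_e … hGA_l2 hE4 hH2`, the residual entries `hGp hGA`, the three letter pins, `hB` and the
[B6] block VERBATIM, and the SAME conclusion.  WHY: the leaf `B9LeafX (carriersYUParHX …)` is indexed by `J` only (`carriersYUParHX_I9`); §3 consumed member-universal rows and
re-indexed them itself (`…_reindex f`), which forces a certificate feeding it to DISPLAY rows 15∕16∕17 at every member of `MemberY` although the leaf reads them at `f j` only
(dag-n06-d OWNER CENSUS on IR-N06-SECTION-2, 2026-08-31); a producer cone re-typed along `f` (the J-twins, R1) feeds THIS constructor and displays nothing off the sub-family.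
Proof = §3's proof with the three whole-family derivations `thm31_of_thm37 ∕ thm32_of_thm39 ∕ thm33_of_thm37_310` run at the index type `J` and the fourteen `…_reindex f` calls
dropped; the `U ≡ 1` block is still derived over the full family from `h6` and re-indexed (`baseU1Printed_reindex f`).  A full-family caller recovers §3 by passing
`thm37Printed_reindex f … t37`, etc.
[cite: Balaban1985BackgroundPropagators, Thms 3.1–3.15 pp.397–432, Thm 3.4 p.400, Cor. 3.5 proof p.407, p.410, (3.19) p.393, (3.21) p.394, (3.40) p.397, (3.35)–(3.37) p.396; Balaban1985Averaging, Prop. 2 p.26; Balaban1984PropagatorsII, Props. 2.2, 2.3, 2.6] -/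
theorem b9LeafX_carriersYUParHX_ofReindexed (δ₀ : ℝ) {Jt Kt : Type} (tree : Jt → B6.TreeData) (loc : Kt → B6.LocalOp)
    (hone : ∀ (j : J) (α₀ : ℝ), 0 < α₀ → regC335 𝔸 G P (f j) c35Y α₀ (bg9YC 𝔸 G P (f j)).one)
    (hGp_e : ∀ (x : MemberY d ℓ hd hL b₀ b₁ Mstar) (n : Fin 4) (lam : (geo9Y x).Loc) (y : (geo9Y x).Site),
      (ops x).Gp.e n (bg9Y 𝔸 G x).one lam y ≤ (Node00.GpU x.toKIdx).e n lam y)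
    (hGp_h1 : ∀ (x : MemberY d ℓ hd hL b₀ b₁ Mstar) (lam : (geo9Y x).Loc) (b : ℝ) (ζ : (geo9Y x).Cut),
      (ops x).Gp.h1 (bg9Y 𝔸 G x).one lam b ζ ≤ (Node00.GpU x.toKIdx).h1 lam b ζ)
    (hC : ∀ (x : MemberY d ℓ hd hL b₀ b₁ Mstar) (y y' : (geo9Y x).Site), |(ops x).Cinv.ker (bg9Y 𝔸 G x).one y y'| ≤ |(Node00.CinvU x.toKIdx).ker y y'|)
    (hGA_e : ∀ (x : MemberY d ℓ hd hL b₀ b₁ Mstar) (n : Fin 4) (lam : (geo9Y x).Loc) (y : (geo9Y x).Site),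
      (ops x).GA.e n (bg9Y 𝔸 G x).one lam y ≤ (Node00.GU x.toKIdx).e n lam y)
    (hGA_h1 : ∀ (x : MemberY d ℓ hd hL b₀ b₁ Mstar) (lam : (geo9Y x).Loc) (b : ℝ) (ζ : (geo9Y x).Cut),
      (ops x).GA.h1 (bg9Y 𝔸 G x).one lam b ζ ≤ (Node00.GU x.toKIdx).h1 lam b ζ)
    (hGA_e4 : ∀ (x : MemberY d ℓ hd hL b₀ b₁ Mstar) (lam : (geo9Y x).Loc) (y : (geo9Y x).Site),
      (ops x).GA.e4 (bg9Y 𝔸 G x).one lam y ≤ (Node00.GU x.toKIdx).e4 lam y)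
    (hGA_h2 : ∀ (x : MemberY d ℓ hd hL b₀ b₁ Mstar) (lam : (geo9Y x).Loc) (b : ℝ) (ζ : (geo9Y x).Cut),
      (ops x).GA.h2 (bg9Y 𝔸 G x).one lam b ζ ≤ (Node00.GU x.toKIdx).h2 lam b ζ)
    (hGA_l2 : ∀ (x : MemberY d ℓ hd hL b₀ b₁ Mstar) (n : Fin 6) (lam : (geo9Y x).Loc) (h : (geo9Y x).Cut),
      (ops x).GA.l2 n (bg9Y 𝔸 G x).one lam h ≤ (Node00.GU x.toKIdx).l2 n lam h)
    (hE4 : ∀ (x : MemberY d ℓ hd hL b₀ b₁ Mstar) (lam : (geo9Y x).Loc), ¬ (lam.isRight = true) → ∀ y, (ops x).GA.e4 (bg9Y 𝔸 G x).one lam y ≤ 0)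
    (hH2 : ∀ (x : MemberY d ℓ hd hL b₀ b₁ Mstar) (lam : (geo9Y x).Loc), ¬ (lam.isRight = true) →
      ∀ (β : ℝ) (ζ : (geo9Y x).Cut), (ops x).GA.h2 (bg9Y 𝔸 G x).one lam β ζ ≤ 0)
    (hGp : B9FromB6.ResidualGpAtOne geo9Y (bg9YR 𝔸 G (regC335 𝔸 G P) (regC336 𝔸 G P)) (fun x => kernelFamilyR (regC335 𝔸 G P) (regC336 𝔸 G P) (ops x).Gp))
    (hGA : B9FromB6.ResidualGAGlobAtOne geo9Y (bg9YR 𝔸 G (regC335 𝔸 G P) (regC336 𝔸 G P)) (fun x => kernelFamilyR (regC335 𝔸 G P) (regC336 𝔸 G P) (ops x).GA))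
    (hGpPin : ∀ j : J, kernelFamilyR (regC335 𝔸 G P) (regC336 𝔸 G P) (ops (f j)).Gp =
      kernelFamilyS (f j).toKIdx (bg9YC 𝔸 G P (f j)) (fun U => U) (GpY (f j).toKIdx (parA j)) (parH j))
    (hGAPin : ∀ j : J, kernelFamilyR (regC335 𝔸 G P) (regC336 𝔸 G P) (ops (f j)).GA =
      kernelFamilyB (f j).toKIdx (bg9YC 𝔸 G P (f j)) (fun U => U)
        (OA j) (parBY (f j).toKIdx))
    (hCinvPin : ∀ j : J, siteKernelR (regC335 𝔸 G P) (regC336 𝔸 G P) (ops (f j)).Cinv = CinvY P f G parA j)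
    (hB : B9.Thm32Printed (d + 1) c35Y (fun j => geo9Y (f j)) (fun j => bg9YC 𝔸 G P (f j)) (CinvY P f G parA) →
      B9.Thm33Printed c35Y (fun j => geo9Y (f j)) (fun j => bg9YC 𝔸 G P (f j))
        (fun j => kernelFamilyS (f j).toKIdx (bg9YC 𝔸 G P (f j)) (fun U => U) (GpY (f j).toKIdx (parA j)) (parH j))
        (fun j => kernelFamilyB (f j).toKIdx (bg9YC 𝔸 G P (f j)) (fun U => U)
          (OA j) (parBY (f j).toKIdx)) →
      SectBStepUPar P f (d + 1) c35Y G b parA parH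
        OA (fun j => parBY (f j).toKIdx)
        C37 C38 (CinvY P f G parA))
    (t37 : B9.Thm37Printed c35Y (fun j => geo9Y (f j)) (fun j => bg9YR 𝔸 G (regC335 𝔸 G P) (regC336 𝔸 G P) (f j)) (fun j => rwExpansionR (regC335 𝔸 G P) (regC336 𝔸 G P) (ops (f j)).E37))
    (c38 : B9.Cor38Printed c35Y (fun j => geo9Y (f j)) (fun j => bg9YR 𝔸 G (regC335 𝔸 G P) (regC336 𝔸 G P) (f j)) (fun j => rwExpansionR (regC335 𝔸 G P) (regC336 𝔸 G P) (ops (f j)).E37))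
    (t39 : B9.Thm39Printed (d + 1) c35Y (fun j => geo9Y (f j)) (fun j => bg9YR 𝔸 G (regC335 𝔸 G P) (regC336 𝔸 G P) (f j))
      (fun j => rwKernelExpansionR (regC335 𝔸 G P) (regC336 𝔸 G P) (ops (f j)).EK39))
    (t310 : B9.Thm310Printed c35Y (fun j => geo9Y (f j)) (fun j => bg9YR 𝔸 G (regC335 𝔸 G P) (regC336 𝔸 G P) (f j)) (fun j => rwExpansionR (regC335 𝔸 G P) (regC336 𝔸 G P) (ops (f j)).E310))
    (hsum : B9.RWSumsYieldIneqs (fun j => geo9Y (f j)) (fun j => bg9YR 𝔸 G (regC335 𝔸 G P) (regC336 𝔸 G P) (f j)) (fun j => rwExpansionR (regC335 𝔸 G P) (regC336 𝔸 G P) (ops (f j)).E37)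
      (fun j => rwExpansionR (regC335 𝔸 G P) (regC336 𝔸 G P) (ops (f j)).E310) (fun j => kernelFamilyR (regC335 𝔸 G P) (regC336 𝔸 G P) (ops (f j)).Gp)
      (fun j => kernelFamilyR (regC335 𝔸 G P) (regC336 𝔸 G P) (ops (f j)).GA))
    (hksum : B9.RWKernelSumYields (d + 1) (fun j => geo9Y (f j)) (fun j => bg9YR 𝔸 G (regC335 𝔸 G P) (regC336 𝔸 G P) (f j))
      (fun j => rwKernelExpansionR (regC335 𝔸 G P) (regC336 𝔸 G P) (ops (f j)).EK39) (fun j => siteKernelR (regC335 𝔸 G P) (regC336 𝔸 G P) (ops (f j)).Cinv))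
    (t311 : B9.Thm311Printed c35Y (fun j => geo9Y (f j)) (fun j => bg9YR 𝔸 G (regC335 𝔸 G P) (regC336 𝔸 G P) (f j)) (fun j => (ops (f j)).PosDef))
    (t312 : B9.Thm312Printed (d + 1) c35Y (fun j => geo9Y (f j)) (fun j => bg9YR 𝔸 G (regC335 𝔸 G P) (regC336 𝔸 G P) (f j))
      (fun j => kernelFamilyR (regC335 𝔸 G P) (regC336 𝔸 G P) (ops (f j)).GD) (fun j => kernelFamilyR (regC335 𝔸 G P) (regC336 𝔸 G P) (ops (f j)).G₁)
      (fun j => hKernelR (regC335 𝔸 G P) (regC336 𝔸 G P) (ops (f j)).H) (fun j => hKernelR (regC335 𝔸 G P) (regC336 𝔸 G P) (ops (f j)).H₁)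
      (fun j K => (ops (f j)).HasRWExp (kernelFamilyRY K)) (fun j K => (ops (f j)).HasRWExpH (hKernelRY K)) (fun j K => (ops (f j)).PosDefK (kernelFamilyRY K)))
    (t313 : B9.Thm313Printed c35Y (fun j => geo9Y (f j)) (fun j => bg9YR 𝔸 G (regC335 𝔸 G P) (regC336 𝔸 G P) (f j)) (fun j => kernelFamilyR (regC335 𝔸 G P) (regC336 𝔸 G P) (ops (f j)).GG)
      (fun j K => (ops (f j)).HasRWExp (kernelFamilyRY K)) (fun j K => (ops (f j)).PosDefK (kernelFamilyRY K)))
    (t314 : B9.Thm314Printed c35Y (fun j => geo9Y (f j)) (fun j => bg9YR 𝔸 G (regC335 𝔸 G P) (regC336 𝔸 G P) (f j)) (fun j => kernelFamilyR (regC335 𝔸 G P) (regC336 𝔸 G P) (ops (f j)).Kdiff)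
      (fun j => dOmegaY (f j)))
    (t315 : B9.Thm315FullPrinted c35Y (fun j => geo9Y (f j)) (fun j => bg9YR 𝔸 G (regC335 𝔸 G P) (regC336 𝔸 G P) (f j)) (fun j => siteKernelR (regC335 𝔸 G P) (regC336 𝔸 G P) (ops (f j)).Ck)
      (fun j => inΛY (f j)) (fun j => unitDistY (f j)) (fun j => (ops (f j)).GivenBy3185) (fun j => (ops (f j)).HasRWExpC))
    (s349 : B9.Stmt349Printed (d + 1) c35Y (fun j => geo9Y (f j)) (fun j => bg9YR 𝔸 G (regC335 𝔸 G P) (regC336 𝔸 G P) (f j))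
      (fun j => fineKernelR (regC335 𝔸 G P) (regC336 𝔸 G P) (ops (f j)).P349))
    (s3132 : B9.Stmt3132Printed (d + 1) c35Y (fun j => geo9Y (f j)) (fun j => bg9YR 𝔸 G (regC335 𝔸 G P) (regC336 𝔸 G P) (f j))
      (fun j => siteKernelR (regC335 𝔸 G P) (regC336 𝔸 G P) (ops (f j)).QGQinv) (fun j => siteKernelR (regC335 𝔸 G P) (regC336 𝔸 G P) (ops (f j)).QG1Qinv))
    (t314loc : B9Thm314.Thm314LocalPrinted c35Y (fun j => geo9Y (f j)) (fun j => bg9YR 𝔸 G (regC335 𝔸 G P) (regC336 𝔸 G P) (f j))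
      (fun j => kernelFamilyR (regC335 𝔸 G P) (regC336 𝔸 G P) (ops (f j)).Kdiff) (fun j => OmKY (f j)) (fun j => dOmegaY (f j)))
    (h6 : B6BlockParam (Node00.towerBlockOfRecord d ℓ hd hL b₀ b₁ δ₀ tree loc)) :
    B9LeafX (carriersYUParHX P G f b C37 C38 parA parH OA ops) := by
  -- (1) at the record, over the full member family at the classes `(regC335 P, regC336 P)`: the `U ≡ 1` block from [B6], Thms 3.1 ∕ 3.2 ∕ 3.3 from rows 15–19
  have hbaseR : B9.BaseU1Printed (d + 1) geo9Y (bg9YR 𝔸 G (regC335 𝔸 G P) (regC336 𝔸 G P))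
      (fun x => kernelFamilyR (regC335 𝔸 G P) (regC336 𝔸 G P) (ops x).Gp) (fun x => kernelFamilyR (regC335 𝔸 G P) (regC336 𝔸 G P) (ops x).GA)
      (fun x => siteKernelR (regC335 𝔸 G P) (regC336 𝔸 G P) (ops x).Cinv) :=
    baseU1_of_b6BlockParam_on (carriersYR d ℓ hd hL b₀ b₁ Mstar 𝔸 G (regC335 𝔸 G P) (regC336 𝔸 G P) ops).toPrintedCarriers9
      (Node00.towerBlockOfRecord d ℓ hd hL b₀ b₁ δ₀ tree loc) rfl (fun x => ⟨x.toKIdx, x.hcfk⟩)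
      (fun x => dictAtOneY x (kernelFamilyR (regC335 𝔸 G P) (regC336 𝔸 G P) (ops x).Gp) (kernelFamilyR (regC335 𝔸 G P) (regC336 𝔸 G P) (ops x).GA)
        (siteKernelR (regC335 𝔸 G P) (regC336 𝔸 G P) (ops x).Cinv) (hGp_e x) (hGp_h1 x) (hC x) (hGA_e x) (hGA_h1 x) (hGA_e4 x) (hGA_h2 x) (hGA_l2 x))
      (fun _ => fun lam => lam.isRight = true) (fun x => B9GeoNormsKLevelModelSignsV1.modelSignsOn_geo9K x.toKIdx) hE4 hH2 hGp hGA h6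
  have h31J := B9.thm31_of_thm37 c35Y (fun j => geo9Y (f j)) (fun j => bg9YR 𝔸 G (regC335 𝔸 G P) (regC336 𝔸 G P) (f j)) _ _ _ _ t37 hsum
  have h32J := B9.thm32_of_thm39 (d + 1) c35Y (fun j => geo9Y (f j)) (fun j => bg9YR 𝔸 G (regC335 𝔸 G P) (regC336 𝔸 G P) (f j)) _ _ t39 hksum
  have h33J := B9.thm33_of_thm37_310 c35Y (fun j => geo9Y (f j)) (fun j => bg9YR 𝔸 G (regC335 𝔸 G P) (regC336 𝔸 G P) (f j)) _ _ _ _ t37 t310 hsum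
  -- (2) along the subfamily, re-keyed to NODE 00's letter readings by the pins
  have eGp := funext hGpPin
  have eGA := funext hGAPin
  have eC := funext hCinvPin
  have hbaseJ := baseU1Printed_reindex f (d + 1) geo9Y (bg9YR 𝔸 G (regC335 𝔸 G P) (regC336 𝔸 G P)) _ _ _ hbaseR
  rw [eGp, eGA, eC] at hbaseJ
  rw [eGp] at h31J
  rw [eC] at h32J
  rw [eGp, eGA] at h33J
  have h32J' : B9.Thm32Printed (d + 1) c35Y (fun j => geo9Y (f j)) (fun j => bg9YC 𝔸 G P (f j)) (CinvY P f G parA) := h32J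
  have h33J' : B9.Thm33Printed c35Y (fun j => geo9Y (f j)) (fun j => bg9YC 𝔸 G P (f j))
      (fun j => kernelFamilyS (f j).toKIdx (bg9YC 𝔸 G P (f j)) (fun U => U) (GpY (f j).toKIdx (parA j)) (parH j))
      (fun j => kernelFamilyB (f j).toKIdx (bg9YC 𝔸 G P (f j)) (fun U => U)
        (OA j) (parBY (f j).toKIdx)) := h33J
  have hBU := hB h32J' h33J'
  -- (3) over the coded carrier
  have hbaseU := baseU1Printed_codedUPar P G f C38 parA parH
    OA (fun j => parBY (f j).toKIdx)
    C37 (CinvY P f G parA) (d + 1) hbaseJ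
  have h31U := thm31Printed_codedUPar P G f C38 parA parH c35Y C37 h31J
  have h32U := thm32Printed_codedU P f c35Y G C38 (C37 := C37)
    (Cinv := CinvY P f G parA) (d + 1) h32J
  have h33U := thm33Printed_codedUPar P G f C38 parA parH
    OA (fun j => parBY (f j).toKIdx) c35Y
    C37 h33J
  have honeU : ∀ (j : J) (α₀ : ℝ), 0 < α₀ → ((carriersYUParHX P G f b C37 C38 parA parH OA ops).bg9 j).Reg335 c35Y α₀ ((carriersYUParHX P G f b C37 C38 parA parH OA ops).bg9 j).one :=
    fun j α₀ hα => hone j α₀ hα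
  have h35 := B9.cor35_of_sectB_base (d + 1) c35Y (carriersYUParHX P G f b C37 C38 parA parH OA ops).geo9 (carriersYUParHX P G f b C37 C38 parA parH OA ops).bg9
    (carriersYUParHX P G f b C37 C38 parA parH OA ops).Gp (carriersYUParHX P G f b C37 C38 parA parH OA ops).GA (carriersYUParHX P G f b C37 C38 parA parH OA ops).Cinv (carriersYUParHX P G f b C37 C38 parA parH OA ops).IsAnalyticExt
    honeU hbaseU hBU
  have hg : B9.GaugeReduction335 (d + 1) c35Y (carriersYUParHX P G f b C37 C38 parA parH OA ops).geo9 (carriersYUParHX P G f b C37 C38 parA parH OA ops).bg9 (carriersYUParHX P G f b C37 C38 parA parH OA ops).InCube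
      (carriersYUParHX P G f b C37 C38 parA parH OA ops).Gp (carriersYUParHX P G f b C37 C38 parA parH OA ops).GA (carriersYUParHX P G f b C37 C38 parA parH OA ops).Cinv :=
    fun j hj => absurd hj (not_inCubeY (f j))
  have h36 := B9.cor36_of_cor35 (d + 1) c35Y c35Y_pos _ _ _ _ _ _ h35 hg
  have h34 := B9.thm34_of_sectB (d + 1) c35Y (carriersYUParHX P G f b C37 C38 parA parH OA ops).geo9 (carriersYUParHX P G f b C37 C38 parA parH OA ops).bg9
    (carriersYUParHX P G f b C37 C38 parA parH OA ops).Gp (carriersYUParHX P G f b C37 C38 parA parH OA ops).GA (carriersYUParHX P G f b C37 C38 parA parH OA ops).Cinv (carriersYUParHX P G f b C37 C38 parA parH OA ops).IsAnalyticExt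
    hBU h32U h33U
  exact ⟨⟨h35, h36, h31U, h32U, h33U, h34,
      thm37Printed_coded c35Y _ _ (fun j => codingYx P G (f j) (C37 j) (C38 j)) _ t37,
      cor38Printed_coded c35Y _ _ (fun j => codingYx P G (f j) (C37 j) (C38 j)) _ c38,
      thm39Printed_coded (d + 1) c35Y _ _ (fun j => codingYx P G (f j) (C37 j) (C38 j)) _ t39,
      thm310Printed_coded c35Y _ _ (fun j => codingYx P G (f j) (C37 j) (C38 j)) _ t310,
      thm311Printed_coded c35Y _ _ (fun j => codingYx P G (f j) (C37 j) (C38 j)) _ t311,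
      thm312Printed_coded (d + 1) c35Y _ _ (fun j => codingYx P G (f j) (C37 j) (C38 j)) _ _ _ _ _ _ _ t312,
      thm313Printed_coded c35Y _ _ (fun j => codingYx P G (f j) (C37 j) (C38 j)) _ _ _ t313,
      thm314Printed_coded c35Y _ _ (fun j => codingYx P G (f j) (C37 j) (C38 j)) _ _ t314,
      thm315FullPrinted_coded c35Y _ _ (fun j => codingYx P G (f j) (C37 j) (C38 j)) _ _ _ _ _ t315⟩,
    stmt349Printed_coded (d + 1) c35Y _ _ (fun j => codingYx P G (f j) (C37 j) (C38 j)) _ s349,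
    stmt3132Printed_coded (d + 1) c35Y _ _ (fun j => codingYx P G (f j) (C37 j) (C38 j)) _ _ s3132,
    thm314LocalPrinted_coded c35Y _ _ (fun j => codingYx P G (f j) (C37 j) (C38 j)) _ _ _ t314loc⟩


end Knit

end Literature.MathematicalPhysics.QuantumFieldTheory.Balaban1983to89.B9LeafXCodedKnitUParHXJ

end
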